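import Summits.Parity.GeneralizedHardyLittlewood.Theorems.LeeYangFibresCellParityLawKernelDefs
import Summits.Parity.GeneralizedHardyLittlewood.Theorems.LeeYangFibresCellParityLawRelDefs

/-!
# Sketch (lead c4): typed statements for a RELATIVE-budget re-lining of the restated crux `CellParityLawRel`

Nothing is asserted or registered here; these are the exact types a planner re-lining stmt-Parity-14109 on the restated
statement `CellParityLawRel` (`Theorems/LeeYangFibresCellParityLawRelDefs.lean`, p119554) would file, checked to elaborate
against the line's landed vocabulary (`cell`, `walsh`, `modelDensity`, `sectionMass`, `sectionDensity`, `roughCellSum`, …).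

* `SectionLevelFixedAt t` — the atom at a FIXED level `N^{1-η₀}` for every `η₀ > 0` (standard fixed-level shape of tuple-GEH;
  `t = 1`: Elliott–Halberstam-type for shifted rough `Ω`-cells). Compare `SectionLevelAt t` (level `N^{1-(log log N)^{-B}}`).
* `QualitativeRoughCellLaw` — the kernel with ANY rate: for every target accuracy `ε'` SOME deficit `η₀ > 0` works, uniformly over
  admissible sequences (Bombieri 1977's `P_r`-law + FI 1978 §4, uniformised by the contradiction argument). Compare
  `EffectiveRoughCellLaw` (rate `η^κ`).
* `LawRelAt t A` — the relative induction hypothesis with absolute floor `N/(log N)^{t+A}`; `CellParityLawRel` is `∀ t ≥ 1, LawRelAt t 0`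
  up to unfolding `cell`/`walsh`/`modelDensity`. The floors must DECREASE along the induction (`LawRelAt t (A+1)` feeds `LawRelAt (t+1) A`)
  to absorb the section factor `H = 𝔖(Ψ)/𝔖(Ψ₋ᵢ) ≲ log log N` on the absolute part; the relative part absorbs it because
  `𝔖(Ψ₋ᵢ) ∈ {0} ∪ [c(t,L), ∞)`.
* `SectionLawRelAt t A` — the relative one-parameter section law the kernel delivers from the fixed-level atom.
Intended composition: base `LawRelAt 1 A` (PNT level, every `A`), step `LawRelAt t (A+1) → SectionLawRelAt t A → LawRelAt (t+1) A`
(Walsh/tensor step with relative budgets), engine `SectionLevelFixedAt t → QualitativeRoughCellLaw → LawRelAt t (A+1) → SectionLawRelAt t A`.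
-/

noncomputable section

open scoped BigOperators Classical
open Finset Literature.NumberTheory.Sieve

namespace Summit.Parity.GeneralizedHardyLittlewood.Cruxes.CellParityLaw.SectionAnnihilator.RelativeSketch

/-- The section atom at FIXED level `N^{1-η₀}`, every `η₀ > 0`, saving `(log N)^{-A}`, every `A` (sketch; not registered). -/
def SectionLevelFixedAt (t : ℕ) : Prop :=
  ∀ (L u A : ℕ) (η₀ : ℝ), 2 ≤ u → 0 < η₀ → ∃ N₀ : ℕ, ∀ N : ℕ, N₀ ≤ N →
    ∀ Ψ : Fin (t + 1) → AffLinForm 1, IsNondegenerateSystem Ψ → affLinSize Ψ N ≤ L →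
    ∀ K : Set (Fin 1 → ℝ), Convex ℝ K → K ⊆ realBox 1 N →
    ∀ i : Fin (t + 1), ∀ j' : Fin t → ℕ, (∀ k, 1 ≤ j' k ∧ j' k ≤ u) →
      ∑ d ∈ (Finset.Icc 1 ⌊(N : ℝ) ^ (1 - η₀)⌋₊).filter Squarefree,
          |(sectionMass Ψ K N u i j' d : ℝ) - sectionDensity Ψ i d * sectionMass Ψ K N u i j' 1|
        ≤ (N : ℝ) / Real.log N ^ A

/-- The QUALITATIVE uniform rough-cell law (sketch; not registered): as `EffectiveRoughCellLaw`, but for every target accuracy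
`ε' > 0` there is SOME admissible deficit `η₀ > 0` (no rate), the localisation loss `log(2Λ)/log z` kept explicit. -/
def QualitativeRoughCellLaw : Prop :=
  ∀ (u : ℕ) (A₁ L' ε' : ℝ), 2 ≤ u → 0 < ε' → ∃ (η₀ C : ℝ) (A₂ : ℕ) (x₀ : ℝ), 0 < η₀ ∧ 0 ≤ C ∧
    ∀ (𝒜 : SieveSequence) (x z η Λ w₀ R : ℝ), x₀ ≤ x →
      x ^ (1 / ((u : ℝ) + 1)) ≤ z → z ≤ x ^ (1 / (u : ℝ)) →
      Real.log x ^ (-(1 / 2 : ℝ)) ≤ η → η ≤ η₀ →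
      1 ≤ Λ → Λ ≤ x ^ η → 2 ≤ w₀ → w₀ ≤ x ^ η →
      (∀ q : ℕ, 𝒜.a q ≤ 1) → (∀ q : ℕ, x < (q : ℝ) → 𝒜.a q = 0) → (∀ q : ℕ, (q : ℝ) ≤ x / Λ → 𝒜.a q = 0) →
      (∀ y : ℝ, 𝒜.size y = 𝒜.congrSum 1 y) → x ^ (1 - 1 / (4 * (u : ℝ))) ≤ 𝒜.size x →
      (∀ p : ℕ, p.Prime → 𝒜.density p ≤ A₁ / p) → HasIwaniecDimension 𝒜.density 1 L' →
      (∀ w z' : ℝ, w₀ ≤ w → w ≤ z' → z' ≤ x →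
          Real.log z' / Real.log w * (1 - L' / Real.log w) ≤
            ∏ p ∈ (Nat.primesBelow ⌈z'⌉₊).filter (fun p : ℕ => w ≤ (p : ℝ)), (1 - 𝒜.density p)⁻¹) →
      (∀ y : ℝ, y ≤ x →
          ∑ d ∈ (Finset.Icc 1 ⌊x ^ (1 - η)⌋₊).filter Squarefree, |𝒜.remainder d y| ≤ R) →
      ∃ δ : ℝ, 0 ≤ δ ∧ δ ≤ 2 ∧ ∀ m : ℕ, 1 ≤ m →
        |roughCellSum 𝒜 x z m -
            (1 + (δ - 1) * (-1 : ℝ) ^ m) *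
              (roughCellDensity m (Real.log x / Real.log z) / (Real.log x / Real.log z)) *
              (Real.exp Real.eulerMascheroniConstant * 𝒜.densityProduct (primesProdBelow z)) * 𝒜.size x|
          ≤ (ε' + C * (Real.log (2 * Λ) / Real.log z)) *
                (𝒜.densityProduct (primesProdBelow z) * 𝒜.size x) +
              C * Real.log x ^ A₂ * R

/-- The RELATIVE induction hypothesis at layer `t` with absolute floor `N/(log N)^{t+A}` (sketch; not registered):
`CellParityLawRel` is `∀ t ≥ 1, LawRelAt t 0` up to unfolding. -/
def LawRelAt (t A : ℕ) : Prop :=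
  ∀ (L u : ℕ) (ε : ℝ), 2 ≤ u → 0 < ε → ∃ N₀ : ℕ, ∀ N : ℕ, N₀ ≤ N →
    ∀ Ψ : Fin t → AffLinForm 1, IsNondegenerateSystem Ψ → affLinSize Ψ N ≤ L →
    ∀ K : Set (Fin 1 → ℝ), Convex ℝ K → K ⊆ realBox 1 N →
    ∃ θ : Finset (Fin t) → ℝ, θ ∅ = 1 ∧ (∀ S, |θ S| ≤ 2) ∧
      ∀ j : Fin t → ℕ, (∀ i, 1 ≤ j i ∧ j i ≤ u) →
        |(cell Ψ K N u j : ℝ) - walsh θ j * (archFactor Ψ K * singularProduct Ψ * ∏ i, modelDensity N u (j i))|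
          ≤ ε * (archFactor Ψ K * singularProduct Ψ * modelDensity N u 1 ^ t +
                  (N : ℝ) / Real.log N ^ (t + A))

/-- The RELATIVE one-parameter section law at layer `t + 1` with floor `N/(log N)^{t+1+A}` (sketch; not registered). -/
def SectionLawRelAt (t A : ℕ) : Prop :=
  ∀ (L u : ℕ) (ε : ℝ), 2 ≤ u → 0 < ε → ∃ N₀ : ℕ, ∀ N : ℕ, N₀ ≤ N →
    ∀ Ψ : Fin (t + 1) → AffLinForm 1, IsNondegenerateSystem Ψ → affLinSize Ψ N ≤ L →
    ∀ K : Set (Fin 1 → ℝ), Convex ℝ K → K ⊆ realBox 1 N →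
    ∀ i : Fin (t + 1), ∀ j' : Fin t → ℕ, (∀ k, 1 ≤ j' k ∧ j' k ≤ u) →
      ∃ δ : ℝ, 0 ≤ δ ∧ δ ≤ 2 ∧ ∀ m : ℕ, 1 ≤ m → m ≤ u →
        |(cell Ψ K N u (i.insertNth m j') : ℝ) -
            (1 + (δ - 1) * (-1 : ℝ) ^ m) * modelDensity N u m *
              (singularProduct Ψ / singularProduct (Fin.removeNth i Ψ)) * (sectionMass Ψ K N u i j' 1 : ℝ)|
          ≤ ε * (modelDensity N u 1 * (singularProduct Ψ / singularProduct (Fin.removeNth i Ψ)) *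
                    (sectionMass Ψ K N u i j' 1 : ℝ) +
                  (N : ℝ) / Real.log N ^ (t + 1 + A))

/-- Sanity (sketch): the crux as typed implies every relative layer with floor exponent `0` — immediate from
`stub_relOfAbs`'s argument; recorded as the shape of the target, `CellParityLawRel ↔ ∀ t ≥ 1, LawRelAt t 0`
(by `rfl`-unfolding of `cell`, `walsh`, `modelDensity`). -/
theorem lawRelAt_zero_iff :
    (∀ t : ℕ, 1 ≤ t → LawRelAt t 0) ↔ CellParityLawRel := by
  constructor
  · intro h t L u ht hu ε hε
    have h' := h t ht L u ε hu hε
    simpa only [cell, walsh, modelDensity, add_zero] using h'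
  · intro h t ht L u ε hu hε
    have h' := h t L u ht hu ε hε
    simpa only [cell, walsh, modelDensity, add_zero] using h'

end Summit.Parity.GeneralizedHardyLittlewood.Cruxes.CellParityLaw.SectionAnnihilator.RelativeSketch

end
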